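import Mathlib.Analysis.SpecialFunctions.Pow.Real
import HarnessLib

/-!
# THE TIP OF SKELETON ➎, GLUE FACTS: the law scale `q = b^{1/(2(k+1))}`, the core cut `δ_b = √(q−1)`, thresholds, the mid algebra and the tail packing
# (cell ym-idea-1; free-hands support of ⟨stmt-QuantumFields-24197⟩ `SwapVirialDeficit.SwapGluedStiffness`; scalar inputs of the glue `stub_core_tip_of_core`)

Pure real-variable bookkeeping used by the glue of the tip of skeleton ➎ (`halfBound_pos_of_core`):
* `lawScale_facts` — with `n = 2(k+1)` and `4^{k+1} ≤ b`: `q := b^{1/n} ≥ 2`, `q^n = b`, `√b = q^{k+1}`, and `x^n ≤ b ⇒ x ≤ q`;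
* `deltaB_facts` — `δ_b := √(q−1) ≥ 1`, `δ_b^{-3/4} ≤ 2·q^{-3/8}`, the law window `q⁻¹ ≤ 4δ²/(1+δ²)², q⁻¹ ≤ (1+δ²)⁻¹` for `1 ≤ δ ≤ δ_b`, and `1 + S² ≤ q ⇒ S ≤ δ_b`;
* `lawThreshold_of_root`, `lawError_le_one`, `lawTail_exponent` — the law's threshold `(X·q^k)² ≤ q^n`, error `X q^k/q^{k+1} ≤ 1` and tail exponent `q^{k+1}/X^k ≤ q^n (q⁻¹/X)^k`;
* `q_rpow_neg_eq` — `q^{-3/8} = b^{-(3/(8n))}`;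
* `tipMid_algebra` — `(1+E)G·cc(X_b+X_d) + Mass·e^{-t}·cc·I₁ ≤ 2(c_B+c_D)(G·M) + Mass·cc·e^{-t}` (`E, I₁ ≤ 1`);
* `tipTails_le` — `κ(Mass·cc·e^{-t₁} + cc·e^{CT·L^{pT} − t₂}) ≤ exp((28 + cc + ℓ + |CT|)·L^P − x₀)` for `κ ≤ 9L⁴`, `Mass ≤ e^{ℓ+18L⁴}`, `x₀ ≤ t₁, t₂`.

HONEST LABEL: elementary; `stub_core_tip` (hCore multi-seat + glue), ⟨24197⟩ ∕ ⟨24194⟩ OPEN; item of record ⟨24085⟩ aside ∕ untouched; the Yang–Mills mass gap is NOT proved;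
no summit is proved by a line.  THEOREMS ONLY (0 `def`, 0 `sorry`), standard axioms, no instances.  Seat ym-line-fcl-p3 g49, `--supports stmt-QuantumFields-24197`.  References: [folklore].
-/

set_option autoImplicit false

noncomputable section

namespace Summit.QuantumFields.YangMills.Theorems.SwapVirialDeficit.SectorLaplace

/-- ★ The law scale: with `n = 2(k+1)` and `4^{k+1} ≤ b`, `q := b^{1/n}` satisfies `2 ≤ q`, `q^n = b`, `√b = q^{k+1}`, and `x^n ≤ b ⇒ x ≤ q` for `0 ≤ x`. [folklore] -/
theorem lawScale_facts (k : ℕ) {b : ℝ} (hb : (4 : ℝ) ^ (k + 1) ≤ b) :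
    0 < b ∧ 1 ≤ b ∧ 2 ≤ b ^ (((2 * (k + 1) : ℕ) : ℝ)⁻¹) ∧
    (b ^ (((2 * (k + 1) : ℕ) : ℝ)⁻¹)) ^ (2 * (k + 1)) = b ∧
    Real.sqrt b = (b ^ (((2 * (k + 1) : ℕ) : ℝ)⁻¹)) ^ (k + 1) ∧
    ∀ x : ℝ, 0 ≤ x → x ^ (2 * (k + 1)) ≤ b → x ≤ b ^ (((2 * (k + 1) : ℕ) : ℝ)⁻¹) := by
  have h41 : (4 : ℝ) ≤ 4 ^ (k + 1) := by
    calc (4 : ℝ) = 4 ^ 1 := by norm_num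
      _ ≤ 4 ^ (k + 1) := pow_le_pow_right₀ (by norm_num) (by omega)
  have hb0 : 0 < b := by linarith
  have hn : (2 * (k + 1) : ℕ) ≠ 0 := by omega
  have h4 : (4 : ℝ) ^ (k + 1) = 2 ^ (2 * (k + 1)) := by rw [pow_mul]; norm_num
  set q : ℝ := b ^ (((2 * (k + 1) : ℕ) : ℝ)⁻¹) with hq
  have hqn : q ^ (2 * (k + 1)) = b := Real.rpow_inv_natCast_pow hb0.le hn
  have hroot : ∀ x : ℝ, 0 ≤ x → x ^ (2 * (k + 1)) ≤ b → x ≤ q := by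
    intro x hx hxb
    calc x = (x ^ (2 * (k + 1))) ^ (((2 * (k + 1) : ℕ) : ℝ)⁻¹) := (Real.pow_rpow_inv_natCast hx hn).symm
      _ ≤ q := Real.rpow_le_rpow (by positivity) hxb (by positivity)
  have hq2 : 2 ≤ q := hroot 2 (by norm_num) (by rw [← h4]; exact hb)
  have hq0 : 0 ≤ q := by linarith
  have hsqrt : Real.sqrt b = q ^ (k + 1) := by
    have : Real.sqrt (q ^ (2 * (k + 1))) = q ^ (k + 1) := by
      rw [show q ^ (2 * (k + 1)) = (q ^ (k + 1)) ^ 2 by rw [← pow_mul]; ring_nf, Real.sqrt_sq (by positivity)]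
    rwa [hqn] at this
  exact ⟨hb0, by linarith, hq2, hqn, hsqrt, hroot⟩

/-- ★ The core cut `δ_b := √(q−1)` for `2 ≤ q`: `1 ≤ δ_b`, `δ_b^{-3/4} ≤ 2·q^{-3/8}`, the law window for `1 ≤ δ ≤ δ_b`, and `1 + S² ≤ q ⇒ S ≤ δ_b`. [folklore] -/
theorem deltaB_facts {q : ℝ} (hq : 2 ≤ q) :
    1 ≤ Real.sqrt (q - 1) ∧ 0 < q⁻¹ ∧ q⁻¹ ≤ 1 ∧
    Real.sqrt (q - 1) ^ (-(3 / 4 : ℝ)) ≤ 2 * q ^ (-(3 / 8 : ℝ)) ∧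
    (∀ δ : ℝ, 1 ≤ δ → δ ≤ Real.sqrt (q - 1) → q⁻¹ ≤ 4 * δ ^ 2 / (1 + δ ^ 2) ^ 2 ∧ q⁻¹ ≤ (1 + δ ^ 2)⁻¹) ∧
    (∀ S : ℝ, 0 ≤ S → 1 + S ^ 2 ≤ q → S ≤ Real.sqrt (q - 1)) := by
  have hq0 : 0 < q := by linarith
  have hq1 : 1 ≤ q - 1 := by linarith
  have hδ1 : 1 ≤ Real.sqrt (q - 1) := by
    have h := Real.sqrt_le_sqrt hq1
    rwa [Real.sqrt_one] at h
  refine ⟨hδ1, by positivity, inv_le_one_of_one_le₀ (by linarith), ?_, ?_, ?_⟩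
  · -- `δ_b^{-3/4} = (q-1)^{-3/8} ≤ (q/2)^{-3/8} = 2^{3/8} q^{-3/8} ≤ 2 q^{-3/8}`
    have e1 : Real.sqrt (q - 1) ^ (-(3 / 4 : ℝ)) = (q - 1) ^ (-(3 / 8 : ℝ)) := by
      rw [Real.sqrt_eq_rpow, ← Real.rpow_mul (by linarith)]; norm_num
    rw [e1]
    have h1 : (q - 1) ^ (-(3 / 8 : ℝ)) ≤ (q / 2) ^ (-(3 / 8 : ℝ)) :=
      Real.rpow_le_rpow_of_nonpos (by positivity) (by linarith) (by norm_num)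
    have e2 : (q / 2) ^ (-(3 / 8 : ℝ)) = 2 ^ (3 / 8 : ℝ) * q ^ (-(3 / 8 : ℝ)) := by
      rw [Real.div_rpow hq0.le (by norm_num), Real.rpow_neg (by norm_num : (0:ℝ) ≤ 2), div_inv_eq_mul, mul_comm]
    have h2 : (2 : ℝ) ^ (3 / 8 : ℝ) ≤ 2 := by
      calc (2 : ℝ) ^ (3 / 8 : ℝ) ≤ 2 ^ (1 : ℝ) := Real.rpow_le_rpow_of_exponent_le (by norm_num) (by norm_num)
        _ = 2 := Real.rpow_one 2
    have h3 : 0 ≤ q ^ (-(3 / 8 : ℝ)) := Real.rpow_nonneg hq0.le _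
    calc (q - 1) ^ (-(3 / 8 : ℝ)) ≤ (q / 2) ^ (-(3 / 8 : ℝ)) := h1
      _ = 2 ^ (3 / 8 : ℝ) * q ^ (-(3 / 8 : ℝ)) := e2
      _ ≤ 2 * q ^ (-(3 / 8 : ℝ)) := mul_le_mul_of_nonneg_right h2 h3
  · intro δ hδ1' hδb
    have hδ0 : 0 ≤ δ := by linarith
    have hsq : δ ^ 2 ≤ q - 1 := by
      calc δ ^ 2 ≤ Real.sqrt (q - 1) ^ 2 := pow_le_pow_left₀ hδ0 hδb 2
        _ = q - 1 := Real.sq_sqrt (by linarith)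
    have hpos : 0 < 1 + δ ^ 2 := by positivity
    have h2 : q⁻¹ ≤ (1 + δ ^ 2)⁻¹ := by
      apply inv_anti₀ hpos; linarith
    refine ⟨h2.trans ?_, h2⟩
    rw [le_div_iff₀ (by positivity)]
    have hδsq : 1 ≤ δ ^ 2 := by nlinarith
    calc (1 + δ ^ 2)⁻¹ * (1 + δ ^ 2) ^ 2 = 1 + δ ^ 2 := by field_simp
      _ ≤ 4 * δ ^ 2 := by linarith
  · intro S hS hSq
    calc S = Real.sqrt (S ^ 2) := (Real.sqrt_sq hS).symm
      _ ≤ Real.sqrt (q - 1) := Real.sqrt_le_sqrt (by linarith)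

/-- `q^{-3/8} = b^{-(3/(8n))}` for `q = b^{1/n}`, `0 ≤ b`, `n ≠ 0`. [folklore] -/
theorem q_rpow_neg_eq {b : ℝ} (hb : 0 ≤ b) (n : ℕ) (hn : n ≠ 0) :
    (b ^ ((n : ℝ)⁻¹)) ^ (-(3 / 8 : ℝ)) = b ^ (-(3 / (8 * (n : ℝ)))) := by
  rw [← Real.rpow_mul hb]
  congr 1
  have : (n : ℝ) ≠ 0 := by exact_mod_cast hn
  field_simp

/-- The law threshold from the root bound: `X ≤ q ⇒ (X·(1/q⁻¹)^k)² ≤ q^{2(k+1)}` (`0 ≤ X`). [folklore] -/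
theorem lawThreshold_of_root {X q : ℝ} (k : ℕ) (hX : 0 ≤ X) (hXq : X ≤ q) :
    (X * (1 / q⁻¹) ^ k) ^ 2 ≤ q ^ (2 * (k + 1)) := by
  have hq : 0 ≤ q := hX.trans hXq
  rw [one_div, inv_inv]
  calc (X * q ^ k) ^ 2 ≤ (q * q ^ k) ^ 2 := pow_le_pow_left₀ (by positivity) (mul_le_mul_of_nonneg_right hXq (by positivity)) 2
    _ = q ^ (2 * (k + 1)) := by rw [← pow_succ', ← pow_mul]; ring_nf

/-- The law error is at most one past the threshold: `X ≤ q, 0 < q ⇒ X·(1/q⁻¹)^k·(q^{k+1})⁻¹ ≤ 1`. [folklore] -/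
theorem lawError_le_one {X q : ℝ} (k : ℕ) (hXq : X ≤ q) (hq : 0 < q) :
    X * (1 / q⁻¹) ^ k * (q ^ (k + 1))⁻¹ ≤ 1 := by
  rw [one_div, inv_inv, pow_succ, mul_inv, ← mul_assoc, mul_assoc X, mul_inv_cancel₀ (pow_ne_zero k hq.ne'), mul_one]
  rw [mul_inv_le_iff₀ hq, one_mul]; exact hXq

/-- The law tail exponent dominates `√b/X^k`: `q^{k+1}/X^k ≤ q^{2(k+1)}·(q⁻¹/X)^k` for `1 ≤ q`, `0 < X`. [folklore] -/
theorem lawTail_exponent {X q : ℝ} (k : ℕ) (hX : 0 < X) (hq : 1 ≤ q) :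
    q ^ (k + 1) / X ^ k ≤ q ^ (2 * (k + 1)) * (q⁻¹ / X) ^ k := by
  have hq0 : 0 < q := by linarith
  have e : q ^ (2 * (k + 1)) * (q⁻¹ / X) ^ k = q ^ (k + 2) / X ^ k := by
    rw [div_pow, inv_pow]
    field_simp
    ring
  rw [e]
  exact div_le_div_of_nonneg_right (pow_le_pow_right₀ hq (by omega)) (by positivity)

/-- ★ The mid algebra: `cc·X ≤ (1+E)G·cc(X_b+X_d) + Mass·e^{-t}·cc·I₁`, `E ≤ 1`, `I₁ ≤ 1`, `cc X_b ≤ c_B M`, `cc X_d ≤ c_D M`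
`⇒ cc·X ≤ 2(c_B+c_D)(G M) + Mass·cc·e^{-t}`. [folklore] -/
theorem tipMid_algebra {X Xb Xd E G Mass t I₁ M cB cD cc : ℝ} (hcc : 0 < cc) (hE : E ≤ 1) (hG : 0 ≤ G)
    (hMass : 0 ≤ Mass) (hI1 : I₁ ≤ 1) (hXb : 0 ≤ Xb) (hXd : 0 ≤ Xd)
    (hlaw : cc * X ≤ (1 + E) * G * (cc * (Xb + Xd)) + Mass * Real.exp (-t) * (cc * I₁))
    (hbox : cc * Xb ≤ cB * M) (hdisc : cc * Xd ≤ cD * M) :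
    cc * X ≤ 2 * (cB + cD) * (G * M) + Mass * cc * Real.exp (-t) := by
  have h1 : cc * (Xb + Xd) ≤ (cB + cD) * M := by rw [mul_add]; linarith
  have h2 : (1 + E) * G * (cc * (Xb + Xd)) ≤ 2 * G * ((cB + cD) * M) :=
    mul_le_mul (mul_le_mul_of_nonneg_right (by linarith) hG) h1 (by positivity) (by positivity)
  have h3 : Mass * Real.exp (-t) * (cc * I₁) ≤ Mass * Real.exp (-t) * cc :=
    mul_le_mul_of_nonneg_left (mul_le_of_le_one_right hcc.le hI1) (by positivity)
  calc cc * X ≤ (1 + E) * G * (cc * (Xb + Xd)) + Mass * Real.exp (-t) * (cc * I₁) := hlaw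
    _ ≤ 2 * G * ((cB + cD) * M) + Mass * Real.exp (-t) * cc := add_le_add h2 h3
    _ = 2 * (cB + cD) * (G * M) + Mass * cc * Real.exp (-t) := by ring

/-- ★ The tail packing: for `1 ≤ L`, `0 ≤ κ ≤ 9L⁴`, `0 ≤ Mass ≤ e^{ℓ+18L⁴}` (`0 ≤ ℓ`), `x₀ ≤ t₁`, `x₀ ≤ t₂`, `pT ≤ P`, `4 ≤ P`, `0 < cc`:
`κ·(Mass·cc·e^{-t₁} + cc·e^{CT·L^{pT} − t₂}) ≤ exp((28 + cc + ℓ + |CT|)·L^P − x₀)`. [folklore] -/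
theorem tipTails_le {Lr κ Mass t₁ t₂ x₀ CT cc ℓ : ℝ} {pT P : ℕ} (hL : 1 ≤ Lr) (hκ0 : 0 ≤ κ) (hκ : κ ≤ 9 * Lr ^ 4)
    (hMass0 : 0 ≤ Mass) (hMass : Mass ≤ Real.exp (ℓ + 18 * Lr ^ 4)) (hℓ : 0 ≤ ℓ) (hx1 : x₀ ≤ t₁) (hx2 : x₀ ≤ t₂)
    (hcc : 0 < cc) (hpT : pT ≤ P) (hP : 4 ≤ P) :
    κ * (Mass * cc * Real.exp (-t₁) + cc * Real.exp (CT * Lr ^ pT - t₂)) ≤ Real.exp ((28 + cc + ℓ + |CT|) * Lr ^ P - x₀) := by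
  have hLP : Lr ^ pT ≤ Lr ^ P := pow_le_pow_right₀ hL hpT
  have hL4 : Lr ^ 4 ≤ Lr ^ P := pow_le_pow_right₀ hL hP
  have hP1 : 1 ≤ Lr ^ P := one_le_pow₀ hL
  have hL40 : 0 ≤ Lr ^ 4 := by positivity
  have hCT : CT * Lr ^ pT ≤ |CT| * Lr ^ P := by
    calc CT * Lr ^ pT ≤ |CT| * Lr ^ pT := mul_le_mul_of_nonneg_right (le_abs_self CT) (by positivity)
      _ ≤ |CT| * Lr ^ P := mul_le_mul_of_nonneg_left hLP (abs_nonneg CT)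
  set A : ℝ := ℓ + 18 * Lr ^ 4 + |CT| * Lr ^ P with hA
  have e1 : Real.exp (-t₁) ≤ Real.exp (-x₀) := Real.exp_le_exp.2 (by linarith)
  have e2 : Real.exp (CT * Lr ^ pT - t₂) ≤ Real.exp A * Real.exp (-x₀) := by
    rw [← Real.exp_add]; exact Real.exp_le_exp.2 (by rw [hA]; nlinarith [abs_nonneg CT, Real.exp_pos ℓ])
  have e3 : Mass ≤ Real.exp A := hMass.trans (Real.exp_le_exp.2 (by rw [hA]; nlinarith [abs_nonneg CT]))
  have hsum : Mass * cc * Real.exp (-t₁) + cc * Real.exp (CT * Lr ^ pT - t₂) ≤ 2 * cc * (Real.exp A * Real.exp (-x₀)) := by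
    have h1 : Mass * cc * Real.exp (-t₁) ≤ Real.exp A * cc * Real.exp (-x₀) :=
      mul_le_mul (mul_le_mul_of_nonneg_right e3 hcc.le) e1 (by positivity) (by positivity)
    have h2 : cc * Real.exp (CT * Lr ^ pT - t₂) ≤ cc * (Real.exp A * Real.exp (-x₀)) := mul_le_mul_of_nonneg_left e2 hcc.le
    linarith
  have h9 : 9 * Lr ^ 4 ≤ Real.exp (9 * Lr ^ 4) := by linarith [Real.add_one_le_exp (9 * Lr ^ 4)]
  have h2e : (2 : ℝ) ≤ Real.exp 1 := by linarith [Real.add_one_le_exp (1:ℝ)]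
  have hcce : cc ≤ Real.exp cc := by linarith [Real.add_one_le_exp cc]
  have hR0 : 0 ≤ Real.exp A * Real.exp (-x₀) := by positivity
  calc κ * (Mass * cc * Real.exp (-t₁) + cc * Real.exp (CT * Lr ^ pT - t₂))
      ≤ (9 * Lr ^ 4) * (2 * cc * (Real.exp A * Real.exp (-x₀))) := mul_le_mul hκ hsum (by positivity) (by positivity)
    _ ≤ Real.exp (9 * Lr ^ 4) * (Real.exp 1 * Real.exp cc * (Real.exp A * Real.exp (-x₀))) := by
        refine mul_le_mul h9 ?_ (by positivity) (by positivity)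
        refine mul_le_mul_of_nonneg_right ?_ hR0
        exact mul_le_mul h2e hcce hcc.le (by positivity)
    _ = Real.exp (9 * Lr ^ 4 + 1 + cc + A - x₀) := by
        simp only [← Real.exp_add]; ring_nf
    _ ≤ Real.exp ((28 + cc + ℓ + |CT|) * Lr ^ P - x₀) := by
        refine Real.exp_le_exp.2 ?_
        rw [hA]
        nlinarith [mul_nonneg hcc.le (sub_nonneg.2 hP1), mul_nonneg hℓ (sub_nonneg.2 hP1), abs_nonneg CT]

end Summit.QuantumFields.YangMills.Theorems.SwapVirialDeficit.SectorLaplace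

end
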